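import Mathlib
import Summits.QuantumFields.YangMills.Theorems.TransportFieldFanoWeightedPlaquetteStub
import Summits.QuantumFields.YangMills.Theorems.TransportFieldFlowInvariance
import Summits.QuantumFields.YangMills.Theorems.LuscherReductionDressedRitzPolyakovLiftShadowChart
import HarnessLib

/-!
# One-link Harnack inequality for the exact zero-flux vacuum: `Ω(U[e ↦ U_e·g]) ≥ exp(−7√2·β·‖g − 1‖_F)·Ω(U)`
# (route `TransportFieldFano`, LINE g17-A, crux ⟨stmt-QuantumFields-23362⟩ helper lane — the tool for the torelon floor of ✓`dWeightedPlaquetteMean_of_logFloor`)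

The residual of the registered stub `stub_dWeightedPlaquetteMean` after ✓`…TransportFieldFanoWeightedPlaquetteStub` is a FLOOR on the torelon
mean `E_{Ω²}[4 − (Re tr P₀)²]` of the exact vacuum.  The mechanism landed here is not zero-mode physics but one-link ultraviolet spread: the
exact eigenfunction `Ω = λ₀⁻¹K_βΩ ≥ 0` inherits from the kernel a LOG-LIPSCHITZ bound along the right shift of a single link,
uniformly in `L` and in the other links.
* §1 Hilbert–Schmidt bookkeeping: `|Re tr(XAY) − Re tr(XBY)| ≤ √2·‖A − B‖_F` when `YX ∈ SU(2)` (Cauchy–Schwarz for the HS pairing,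
  `‖W‖_F = √2` on `SU(2)`); the four-factor telescoping bound for plaquette words; `‖ug − u‖_F = ‖(ug)⁻¹ − u⁻¹‖_F = ‖g − 1‖_F`.
* §2 The shift `U[e ↦ U_e g]` seen by the kernel: the time-like coupling moves by `≤ √2‖g−1‖_F` (one term), every plaquette by
  `≤ √2‖g−1‖_F × #(slots of the plaquette word carrying e)`, and each of the four slots carries `e` for at most `3` plaquettes (the slot maps
  are injective in the base point), so `|S(U[e↦U_e g]) − S(U)| ≤ 12√2‖g−1‖_F` and
  ★ `transferKernel_linkShift_ge`: `K_β(U[e↦U_e g], V) ≥ exp(−7√2·β·‖g−1‖_F)·K_β(U, V)` (`β ≥ 0`).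
* §3 ★★ `vacuum_linkShift_ge` — ONE-LINK HARNACK: for every non-negative bounded measurable `Ω` with `K_βΩ = λ₀Ω` pointwise,
  `Ω(U[e ↦ U_e g]) ≥ exp(−7√2·β·‖g−1‖_F)·Ω(U)` for every link `e`, every `g ∈ SU(2)`, every `U`, every `L`.
HONEST FRAMING: fixed-lattice helper estimates (`--supports 23362`); no stub, crux, rung or summit statement is proved here; nothing about
infinite volume, the continuum or the Yang–Mills mass gap.  No `sorry`, no new definition.
References: [cite: ReedSimonIV1978, Thm. XIII.43]; [cite: SeilerLNP1982, §3].
-/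

set_option autoImplicit false

noncomputable section

open MeasureTheory Filter Topology Real
open Literature.MathematicalPhysics.QuantumFieldTheory (GaugeConfig Site Edge Plaquette wilsonAction plaquetteHolonomy frobNorm
  frobNorm_nonneg abs_re_trace_mul_le frobNorm_unitary_mul frobNorm_mul_unitary frobNorm_sq_of_mem_unitaryGroup frobNorm_sub_comm)
open Literature.MathematicalPhysics.QuantumLattice (fundamentalRep_apply secondCountableTopology_su2)

namespace Summit.QuantumFields.YangMills.Theorems.TransportFieldFano

open Summit.QuantumFields.YangMills.Theorems.FemtoTransferGap

variable {L : ℕ} [NeZero L]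

/-! ## §1 Hilbert–Schmidt bookkeeping on `SU(2)` -/

/-- `‖W‖_F = √2` for `W ∈ SU(2)`. [folklore] -/
theorem frobNorm_coe_su2 (W : SU2) : frobNorm (W : Matrix (Fin 2) (Fin 2) ℂ) = Real.sqrt 2 := by
  have h := frobNorm_sq_of_mem_unitaryGroup (su2_mem_unitaryGroup W)
  rw [Fintype.card_fin] at h
  push_cast at h
  rw [← h, Real.sqrt_sq (frobNorm_nonneg _)]

/-- **One-slot trace perturbation**: `|Re tr(XAY) − Re tr(XBY)| ≤ √2·‖A − B‖_F` whenever `Y·X` is (the matrix of) an element of `SU(2)`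
(cyclicity of the trace and Cauchy–Schwarz for the Hilbert–Schmidt pairing). [folklore] -/
theorem abs_re_trace_slot_sub_le (X Y A B : Matrix (Fin 2) (Fin 2) ℂ) (W : SU2) (hW : (W : Matrix (Fin 2) (Fin 2) ℂ) = Y * X) :
    |(X * A * Y).trace.re - (X * B * Y).trace.re| ≤ Real.sqrt 2 * frobNorm (A - B) := by
  have h1 : (X * A * Y).trace.re - (X * B * Y).trace.re = ((A - B) * (Y * X)).trace.re := by
    rw [← Complex.sub_re, ← Matrix.trace_sub, show X * A * Y - X * B * Y = X * (A - B) * Y by noncomm_ring,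
      Matrix.trace_mul_cycle, Matrix.trace_mul_comm]
  rw [h1]
  calc |((A - B) * (Y * X)).trace.re| ≤ frobNorm (A - B) * frobNorm (Y * X) := abs_re_trace_mul_le _ _
    _ = Real.sqrt 2 * frobNorm (A - B) := by rw [← hW, frobNorm_coe_su2, mul_comm]

/-- **Four-factor telescoping**: for `aᵢ, bᵢ ∈ SU(2)`,
`|Re tr(a₁a₂a₃a₄) − Re tr(b₁b₂b₃b₄)| ≤ √2·(‖a₁−b₁‖_F + ‖a₂−b₂‖_F + ‖a₃−b₃‖_F + ‖a₄−b₄‖_F)`. [folklore] -/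
theorem abs_re_trace_prod_four_sub_le (a₁ a₂ a₃ a₄ b₁ b₂ b₃ b₄ : SU2) :
    |((su2Rep (a₁ * a₂ * a₃ * a₄)).trace).re - ((su2Rep (b₁ * b₂ * b₃ * b₄)).trace).re| ≤
      Real.sqrt 2 * (frobNorm ((a₁ : Matrix (Fin 2) (Fin 2) ℂ) - (b₁ : Matrix (Fin 2) (Fin 2) ℂ)) +
        frobNorm ((a₂ : Matrix (Fin 2) (Fin 2) ℂ) - (b₂ : Matrix (Fin 2) (Fin 2) ℂ)) +
        frobNorm ((a₃ : Matrix (Fin 2) (Fin 2) ℂ) - (b₃ : Matrix (Fin 2) (Fin 2) ℂ)) +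
        frobNorm ((a₄ : Matrix (Fin 2) (Fin 2) ℂ) - (b₄ : Matrix (Fin 2) (Fin 2) ℂ))) := by
  simp only [fundamentalRep_apply, PolyakovLift.su2_coe_mul]
  set A₁ : Matrix (Fin 2) (Fin 2) ℂ := (a₁ : Matrix (Fin 2) (Fin 2) ℂ)
  set A₂ : Matrix (Fin 2) (Fin 2) ℂ := (a₂ : Matrix (Fin 2) (Fin 2) ℂ)
  set A₃ : Matrix (Fin 2) (Fin 2) ℂ := (a₃ : Matrix (Fin 2) (Fin 2) ℂ)
  set A₄ : Matrix (Fin 2) (Fin 2) ℂ := (a₄ : Matrix (Fin 2) (Fin 2) ℂ)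
  set B₁ : Matrix (Fin 2) (Fin 2) ℂ := (b₁ : Matrix (Fin 2) (Fin 2) ℂ)
  set B₂ : Matrix (Fin 2) (Fin 2) ℂ := (b₂ : Matrix (Fin 2) (Fin 2) ℂ)
  set B₃ : Matrix (Fin 2) (Fin 2) ℂ := (b₃ : Matrix (Fin 2) (Fin 2) ℂ)
  set B₄ : Matrix (Fin 2) (Fin 2) ℂ := (b₄ : Matrix (Fin 2) (Fin 2) ℂ)
  -- slot 1: `X = 1`, `Y = A₂A₃A₄`
  have h1 : |(1 * A₁ * (A₂ * A₃ * A₄)).trace.re - (1 * B₁ * (A₂ * A₃ * A₄)).trace.re| ≤ Real.sqrt 2 * frobNorm (A₁ - B₁) :=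
    abs_re_trace_slot_sub_le 1 (A₂ * A₃ * A₄) A₁ B₁ (a₂ * a₃ * a₄) (by simp [A₂, A₃, A₄])
  -- slot 2: `X = B₁`, `Y = A₃A₄`
  have h2 : |(B₁ * A₂ * (A₃ * A₄)).trace.re - (B₁ * B₂ * (A₃ * A₄)).trace.re| ≤ Real.sqrt 2 * frobNorm (A₂ - B₂) :=
    abs_re_trace_slot_sub_le B₁ (A₃ * A₄) A₂ B₂ (a₃ * a₄ * b₁) (by simp [A₃, A₄, B₁])
  -- slot 3: `X = B₁B₂`, `Y = A₄`
  have h3 : |(B₁ * B₂ * A₃ * A₄).trace.re - (B₁ * B₂ * B₃ * A₄).trace.re| ≤ Real.sqrt 2 * frobNorm (A₃ - B₃) :=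
    abs_re_trace_slot_sub_le (B₁ * B₂) A₄ A₃ B₃ (a₄ * (b₁ * b₂)) (by simp [A₄, B₁, B₂])
  -- slot 4: `X = B₁B₂B₃`, `Y = 1`
  have h4 : |(B₁ * B₂ * B₃ * A₄ * 1).trace.re - (B₁ * B₂ * B₃ * B₄ * 1).trace.re| ≤ Real.sqrt 2 * frobNorm (A₄ - B₄) :=
    abs_re_trace_slot_sub_le (B₁ * B₂ * B₃) 1 A₄ B₄ (b₁ * b₂ * b₃) (by simp [B₁, B₂, B₃])
  simp only [Matrix.one_mul, Matrix.mul_one] at h1 h4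
  have e1 : (A₁ * (A₂ * A₃ * A₄)).trace.re = (A₁ * A₂ * A₃ * A₄).trace.re := by simp only [Matrix.mul_assoc]
  have e2 : (B₁ * (A₂ * A₃ * A₄)).trace.re = (B₁ * A₂ * (A₃ * A₄)).trace.re := by simp only [Matrix.mul_assoc]
  have e3 : (B₁ * B₂ * (A₃ * A₄)).trace.re = (B₁ * B₂ * A₃ * A₄).trace.re := by simp only [Matrix.mul_assoc]
  rw [e1] at h1; rw [e2] at h1; rw [e3] at h2
  have key := (abs_sub_le _ _ _).trans (add_le_add ((abs_sub_le _ _ _).trans (add_le_add ((abs_sub_le _ _ _).trans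
    (add_le_add h1 h2)) h3)) h4)
  linarith

/-- `‖u g − u‖_F = ‖g − 1‖_F` (left unitary invariance). [folklore] -/
theorem frobNorm_coe_mul_sub (u g : SU2) :
    frobNorm (((u * g : SU2) : Matrix (Fin 2) (Fin 2) ℂ) - (u : Matrix (Fin 2) (Fin 2) ℂ)) =
      frobNorm ((g : Matrix (Fin 2) (Fin 2) ℂ) - 1) := by
  rw [PolyakovLift.su2_coe_mul, show (u : Matrix (Fin 2) (Fin 2) ℂ) * (g : Matrix (Fin 2) (Fin 2) ℂ) - (u : Matrix (Fin 2) (Fin 2) ℂ) =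
    (u : Matrix (Fin 2) (Fin 2) ℂ) * ((g : Matrix (Fin 2) (Fin 2) ℂ) - 1) by rw [Matrix.mul_sub, Matrix.mul_one],
    frobNorm_unitary_mul (su2_mem_unitaryGroup u)]

/-- `‖(u g)⁻¹ − u⁻¹‖_F = ‖g − 1‖_F` (right unitary invariance and `g⁻¹ − 1 = g⁻¹(1 − g)`). [folklore] -/
theorem frobNorm_coe_mul_inv_sub (u g : SU2) :
    frobNorm ((((u * g)⁻¹ : SU2) : Matrix (Fin 2) (Fin 2) ℂ) - ((u⁻¹ : SU2) : Matrix (Fin 2) (Fin 2) ℂ)) =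
      frobNorm ((g : Matrix (Fin 2) (Fin 2) ℂ) - 1) := by
  have h1 : (((u * g)⁻¹ : SU2) : Matrix (Fin 2) (Fin 2) ℂ) - ((u⁻¹ : SU2) : Matrix (Fin 2) (Fin 2) ℂ) =
      (((g⁻¹ : SU2) : Matrix (Fin 2) (Fin 2) ℂ) - 1) * ((u⁻¹ : SU2) : Matrix (Fin 2) (Fin 2) ℂ) := by
    rw [mul_inv_rev, PolyakovLift.su2_coe_mul, Matrix.sub_mul, Matrix.one_mul]
  have h2 : ((g⁻¹ : SU2) : Matrix (Fin 2) (Fin 2) ℂ) - 1 = ((g⁻¹ : SU2) : Matrix (Fin 2) (Fin 2) ℂ) * (1 - (g : Matrix (Fin 2) (Fin 2) ℂ)) := by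
    rw [Matrix.mul_sub, Matrix.mul_one, ← PolyakovLift.su2_coe_mul, inv_mul_cancel]; rfl
  rw [h1, frobNorm_mul_unitary _ (su2_mem_unitaryGroup u⁻¹), h2, frobNorm_unitary_mul (su2_mem_unitaryGroup g⁻¹),
    frobNorm_sub_comm]

/-! ## §2 The right shift of one link seen by the transfer kernel -/

/-- The size of the shift: `ν(g) = ‖g − 1‖_F`. [folklore] -/
theorem frobNorm_sub_one_nonneg (g : SU2) : 0 ≤ frobNorm ((g : Matrix (Fin 2) (Fin 2) ℂ) - 1) := frobNorm_nonneg _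

omit [NeZero L] in
/-- Per-link displacement under `U[e ↦ U_e g]`: `‖U'_l − U_l‖_F = ‖g−1‖_F` if `l = e`, else `0`. [folklore] -/
theorem frobNorm_update_sub (U : GaugeConfig 3 L SU2) (e : Edge 3 L) (g : SU2) (l : Edge 3 L) :
    frobNorm (((Function.update U e (U e * g) l : SU2) : Matrix (Fin 2) (Fin 2) ℂ) - (U l : Matrix (Fin 2) (Fin 2) ℂ)) =
      if l = e then frobNorm ((g : Matrix (Fin 2) (Fin 2) ℂ) - 1) else 0 := by
  by_cases h : l = e
  · subst h; rw [if_pos rfl, Function.update_self, frobNorm_coe_mul_sub]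
  · rw [if_neg h, Function.update_of_ne h, sub_self]
    unfold frobNorm; simp

omit [NeZero L] in
/-- Per-link displacement of the inverses: `‖U'_l⁻¹ − U_l⁻¹‖_F = ‖g−1‖_F` if `l = e`, else `0`. [folklore] -/
theorem frobNorm_update_inv_sub (U : GaugeConfig 3 L SU2) (e : Edge 3 L) (g : SU2) (l : Edge 3 L) :
    frobNorm ((((Function.update U e (U e * g) l)⁻¹ : SU2) : Matrix (Fin 2) (Fin 2) ℂ) - (((U l)⁻¹ : SU2) : Matrix (Fin 2) (Fin 2) ℂ)) =
      if l = e then frobNorm ((g : Matrix (Fin 2) (Fin 2) ℂ) - 1) else 0 := by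
  by_cases h : l = e
  · subst h; rw [if_pos rfl, Function.update_self, frobNorm_coe_mul_inv_sub]
  · rw [if_neg h, Function.update_of_ne h, sub_self]
    unfold frobNorm; simp

omit [NeZero L] in
/-- **One plaquette** under `U[e ↦ U_e g]`: the change of `Re tr U_p` is at most `√2‖g−1‖_F` times the number of slots of the word
`U(z,i)U(z+î,j)U(z+ĵ,i)⁻¹U(z,j)⁻¹` occupied by `e`. [folklore] -/
theorem abs_re_trace_plaquette_update_sub_le (U : GaugeConfig 3 L SU2) (e : Edge 3 L) (g : SU2) (z : Site 3 L) (i j : Fin 3) :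
    |((su2Rep (plaquetteHolonomy (Function.update U e (U e * g)) z i j)).trace).re -
        ((su2Rep (plaquetteHolonomy U z i j)).trace).re| ≤
      Real.sqrt 2 * frobNorm ((g : Matrix (Fin 2) (Fin 2) ℂ) - 1) *
        ((if (z, i) = e then 1 else 0) + (if (z.shift i, j) = e then 1 else 0) + (if (z.shift j, i) = e then 1 else 0) +
          (if (z, j) = e then 1 else 0)) := by
  unfold plaquetteHolonomy
  have h := abs_re_trace_prod_four_sub_le (Function.update U e (U e * g) (z, i)) (Function.update U e (U e * g) (z.shift i, j))
    (Function.update U e (U e * g) (z.shift j, i))⁻¹ (Function.update U e (U e * g) (z, j))⁻¹ (U (z, i)) (U (z.shift i, j))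
    (U (z.shift j, i))⁻¹ (U (z, j))⁻¹
  rw [frobNorm_update_sub, frobNorm_update_sub, frobNorm_update_inv_sub, frobNorm_update_inv_sub] at h
  refine h.trans (le_of_eq ?_)
  split_ifs <;> ring

/-- **Slot counting**: a slot map `(z, q) ↦ s(z, q) ∈ Edges` that is injective in the base point `z` hits a given edge `e` for at most `3`
plaquettes (one per orientation `q`). [folklore] -/
theorem sum_plaquette_indicator_le_three (e : Edge 3 L) (s : Site 3 L → {p : Fin 3 × Fin 3 // p.1 < p.2} → Edge 3 L)
    (hs : ∀ q, Function.Injective fun z => s z q) :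
    ∑ p : Plaquette 3 L, (if s p.1 p.2 = e then (1 : ℝ) else 0) ≤ 3 := by
  classical
  rw [Fintype.sum_prod_type, Finset.sum_comm]
  have hq : ∀ q : {p : Fin 3 × Fin 3 // p.1 < p.2}, ∑ z : Site 3 L, (if s z q = e then (1 : ℝ) else 0) ≤ 1 := by
    intro q
    rw [Finset.sum_boole]
    have hc : (Finset.univ.filter fun z : Site 3 L => s z q = e).card ≤ 1 := by
      refine Finset.card_le_one.mpr fun a ha b hb => ?_
      rw [Finset.mem_filter] at ha hb
      exact hs q (ha.2.trans hb.2.symm)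
    exact_mod_cast hc
  calc ∑ q : {p : Fin 3 × Fin 3 // p.1 < p.2}, ∑ z : Site 3 L, (if s z q = e then (1 : ℝ) else 0)
      ≤ ∑ _q : {p : Fin 3 × Fin 3 // p.1 < p.2}, (1 : ℝ) := Finset.sum_le_sum fun q _ => hq q
    _ = 3 := by
        rw [Finset.sum_const, Finset.card_univ, show Fintype.card {p : Fin 3 × Fin 3 // p.1 < p.2} = 3 by decide]
        norm_num

omit [NeZero L] in
/-- `z ↦ z + ê_k` is injective on the torus. [folklore] -/
theorem shift_injective (k : Fin 3) : Function.Injective fun z : Site 3 L => z.shift k :=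
  fun a b h => by simpa [Site.shift] using h

/-- ★ **The Wilson action under the shift of one link**: `|S(U[e ↦ U_e g]) − S(U)| ≤ 12√2·‖g − 1‖_F` (each of the four slots of a
plaquette word carries `e` for at most three plaquettes). [cite: SeilerLNP1982, §3] -/
theorem abs_wilsonAction_update_sub_le (U : GaugeConfig 3 L SU2) (e : Edge 3 L) (g : SU2) :
    |wilsonAction su2Rep (Function.update U e (U e * g)) - wilsonAction su2Rep U| ≤
      12 * Real.sqrt 2 * frobNorm ((g : Matrix (Fin 2) (Fin 2) ℂ) - 1) := by
  classical
  set ν : ℝ := frobNorm ((g : Matrix (Fin 2) (Fin 2) ℂ) - 1) with hν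
  have hν0 : 0 ≤ ν := frobNorm_nonneg _
  unfold wilsonAction
  rw [← Finset.sum_sub_distrib]
  refine (Finset.abs_sum_le_sum_abs _ _).trans ?_
  have hterm : ∀ p : Plaquette 3 L,
      abs ((((2 : ℕ) : ℝ) - ((su2Rep (plaquetteHolonomy (Function.update U e (U e * g)) p.1 p.2.1.1 p.2.1.2)).trace).re) -
          (((2 : ℕ) : ℝ) - ((su2Rep (plaquetteHolonomy U p.1 p.2.1.1 p.2.1.2)).trace).re)) ≤
        Real.sqrt 2 * ν * ((if (p.1, p.2.1.1) = e then 1 else 0) + (if (p.1.shift p.2.1.1, p.2.1.2) = e then 1 else 0) +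
          (if (p.1.shift p.2.1.2, p.2.1.1) = e then 1 else 0) + (if (p.1, p.2.1.2) = e then 1 else 0)) := by
    intro p
    rw [show (((2 : ℕ) : ℝ) - ((su2Rep (plaquetteHolonomy (Function.update U e (U e * g)) p.1 p.2.1.1 p.2.1.2)).trace).re) -
          (((2 : ℕ) : ℝ) - ((su2Rep (plaquetteHolonomy U p.1 p.2.1.1 p.2.1.2)).trace).re) =
        -((((su2Rep (plaquetteHolonomy (Function.update U e (U e * g)) p.1 p.2.1.1 p.2.1.2)).trace).re -
          ((su2Rep (plaquetteHolonomy U p.1 p.2.1.1 p.2.1.2)).trace).re)) by ring, abs_neg]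
    exact abs_re_trace_plaquette_update_sub_le U e g p.1 p.2.1.1 p.2.1.2
  refine (Finset.sum_le_sum fun p _ => hterm p).trans ?_
  rw [← Finset.mul_sum, Finset.sum_add_distrib, Finset.sum_add_distrib, Finset.sum_add_distrib]
  have h1 := sum_plaquette_indicator_le_three e (fun z q => (z, q.1.1)) fun q a b h => by simpa using congrArg Prod.fst h
  have h2 := sum_plaquette_indicator_le_three e (fun z q => (z.shift q.1.1, q.1.2)) fun q a b h =>
    shift_injective q.1.1 (by simpa using congrArg Prod.fst h)
  have h3 := sum_plaquette_indicator_le_three e (fun z q => (z.shift q.1.2, q.1.1)) fun q a b h =>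
    shift_injective q.1.2 (by simpa using congrArg Prod.fst h)
  have h4 := sum_plaquette_indicator_le_three e (fun z q => (z, q.1.2)) fun q a b h => by simpa using congrArg Prod.fst h
  have hsum : (∑ p : Plaquette 3 L, (if (p.1, p.2.1.1) = e then (1 : ℝ) else 0)) +
      (∑ p : Plaquette 3 L, (if (p.1.shift p.2.1.1, p.2.1.2) = e then (1 : ℝ) else 0)) +
      (∑ p : Plaquette 3 L, (if (p.1.shift p.2.1.2, p.2.1.1) = e then (1 : ℝ) else 0)) +
      (∑ p : Plaquette 3 L, (if (p.1, p.2.1.2) = e then (1 : ℝ) else 0)) ≤ 12 := by linarith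
  calc Real.sqrt 2 * ν * _ ≤ Real.sqrt 2 * ν * 12 := mul_le_mul_of_nonneg_left hsum (by positivity)
    _ = 12 * Real.sqrt 2 * ν := by ring

/-- ★ **The time-like coupling under the shift of one link of the first slice**: `|T(U[e↦U_e g], V) − T(U, V)| ≤ √2‖g − 1‖_F`
(one term of the sum moves). [cite: SeilerLNP1982, §3] -/
theorem abs_timeCoupling_update_sub_le (U V : GaugeConfig 3 L SU2) (e : Edge 3 L) (g : SU2) :
    |timeCoupling su2Rep (Function.update U e (U e * g)) V - timeCoupling su2Rep U V| ≤
      Real.sqrt 2 * frobNorm ((g : Matrix (Fin 2) (Fin 2) ℂ) - 1) := by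
  classical
  unfold timeCoupling
  rw [← Finset.sum_sub_distrib, Finset.sum_eq_single e]
  · rw [Function.update_self]
    have h := abs_re_trace_slot_sub_le (U e : Matrix (Fin 2) (Fin 2) ℂ) (((V e)⁻¹ : SU2) : Matrix (Fin 2) (Fin 2) ℂ)
      (g : Matrix (Fin 2) (Fin 2) ℂ) 1 ((V e)⁻¹ * U e) (PolyakovLift.su2_coe_mul _ _)
    simpa only [fundamentalRep_apply, PolyakovLift.su2_coe_mul, Matrix.mul_one] using h
  · intro l _ hl
    rw [Function.update_of_ne hl, sub_self]
  · intro h; exact absurd (Finset.mem_univ e) h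

/-- ★ **Kernel comparison along one link**: `K_β(U[e ↦ U_e g], V) ≥ exp(−7√2·β·‖g − 1‖_F)·K_β(U, V)` for `β ≥ 0`
(`√2` from the time-like term, `6√2 = ½·12√2` from the magnetic term of the first slice). [cite: SeilerLNP1982, §3] -/
theorem transferKernel_linkShift_ge {β : ℝ} (hβ : 0 ≤ β) (U V : GaugeConfig 3 L SU2) (e : Edge 3 L) (g : SU2) :
    Real.exp (-(7 * Real.sqrt 2 * β * frobNorm ((g : Matrix (Fin 2) (Fin 2) ℂ) - 1))) * transferKernel su2Rep β U V ≤
      transferKernel su2Rep β (Function.update U e (U e * g)) V := by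
  set ν : ℝ := frobNorm ((g : Matrix (Fin 2) (Fin 2) ℂ) - 1) with hν
  unfold transferKernel
  rw [← Real.exp_add]
  refine Real.exp_le_exp.mpr ?_
  have hT := abs_timeCoupling_update_sub_le U V e g
  have hS := abs_wilsonAction_update_sub_le U e g
  rw [abs_le] at hT hS
  have h1 : β * (timeCoupling su2Rep U V - Real.sqrt 2 * ν) ≤ β * timeCoupling su2Rep (Function.update U e (U e * g)) V :=
    mul_le_mul_of_nonneg_left (by linarith [hT.1]) hβ
  have h2 : β / 2 * (wilsonAction su2Rep (Function.update U e (U e * g)) + wilsonAction su2Rep V) ≤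
      β / 2 * (wilsonAction su2Rep U + wilsonAction su2Rep V + 12 * Real.sqrt 2 * ν) :=
    mul_le_mul_of_nonneg_left (by linarith [hS.2]) (by linarith)
  nlinarith [h1, h2]

/-! ## §3 The one-link Harnack inequality for the exact vacuum -/

/-- ★★ **ONE-LINK HARNACK for the exact vacuum.**  Let `Ω ≥ 0` be bounded measurable with `K_βΩ = λ₀Ω` pointwise (`β ≥ 0`, so `λ₀ > 0`).
Then for every link `e`, every `g ∈ SU(2)` and every configuration `U`:
`Ω(U[e ↦ U_e g]) ≥ exp(−7√2·β·‖g − 1‖_F)·Ω(U)` — uniformly in `L` and in all other links.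
(`λ₀Ω(U[e↦U_e g]) = ∫K_β(U[e↦U_e g],V)Ω(V)dV ≥ e^{−c}∫K_β(U,V)Ω(V)dV = e^{−c}λ₀Ω(U)`.) [cite: ReedSimonIV1978, Thm. XIII.43] -/
theorem vacuum_linkShift_ge {β : ℝ} (hβ : 0 ≤ β) {Ω : GaugeConfig 3 L SU2 → ℝ} (hΩm : Measurable Ω) {C : ℝ}
    (hΩb : ∀ U, |Ω U| ≤ C) (hΩnn : ∀ U, 0 ≤ Ω U) (heig : transferApply β Ω = topValue su2Rep L β • Ω)
    (e : Edge 3 L) (g : SU2) (U : GaugeConfig 3 L SU2) :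
    Real.exp (-(7 * Real.sqrt 2 * β * frobNorm ((g : Matrix (Fin 2) (Fin 2) ℂ) - 1))) * Ω U ≤
      Ω (Function.update U e (U e * g)) := by
  haveI : SecondCountableTopology SU2 := secondCountableTopology_su2
  set c : ℝ := 7 * Real.sqrt 2 * β * frobNorm ((g : Matrix (Fin 2) (Fin 2) ℂ) - 1) with hc
  set U' : GaugeConfig 3 L SU2 := Function.update U e (U e * g) with hU'
  have hT := topValue_su2Rep_pos L β
  have hKU : transferApply β Ω U = topValue su2Rep L β * Ω U := by
    have := congrFun heig U; simpa only [Pi.smul_apply, smul_eq_mul] using this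
  have hKU' : transferApply β Ω U' = topValue su2Rep L β * Ω U' := by
    have := congrFun heig U'; simpa only [Pi.smul_apply, smul_eq_mul] using this
  rw [transferApply_apply] at hKU hKU'
  -- compare the two integrals pointwise
  have hmono : ∫ V, Real.exp (-c) * (transferKernel su2Rep β U V * Ω V) ∂configMeasure SU2 L ≤
      ∫ V, transferKernel su2Rep β U' V * Ω V ∂configMeasure SU2 L := by
    refine integral_mono ((integrable_transferKernel_mul β U hΩm hΩb).const_mul _)
      (integrable_transferKernel_mul β U' hΩm hΩb) fun V => ?_
    dsimp only
    rw [← mul_assoc]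
    exact mul_le_mul_of_nonneg_right (transferKernel_linkShift_ge hβ U V e g) (hΩnn V)
  rw [integral_const_mul, hKU, hKU'] at hmono
  have h : topValue su2Rep L β * (Real.exp (-c) * Ω U) ≤ topValue su2Rep L β * Ω U' := by
    calc topValue su2Rep L β * (Real.exp (-c) * Ω U) = Real.exp (-c) * (topValue su2Rep L β * Ω U) := by ring
      _ ≤ topValue su2Rep L β * Ω U' := hmono
  exact le_of_mul_le_mul_left h hT

/-- ★★ **Squared form** (the one used under `Ω² dU`): `exp(−14√2·β·‖g − 1‖_F)·Ω(U)² ≤ Ω(U[e ↦ U_e g])²`. [cite: ReedSimonIV1978, Thm. XIII.43] -/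
theorem vacuum_sq_linkShift_ge {β : ℝ} (hβ : 0 ≤ β) {Ω : GaugeConfig 3 L SU2 → ℝ} (hΩm : Measurable Ω) {C : ℝ}
    (hΩb : ∀ U, |Ω U| ≤ C) (hΩnn : ∀ U, 0 ≤ Ω U) (heig : transferApply β Ω = topValue su2Rep L β • Ω)
    (e : Edge 3 L) (g : SU2) (U : GaugeConfig 3 L SU2) :
    Real.exp (-(14 * Real.sqrt 2 * β * frobNorm ((g : Matrix (Fin 2) (Fin 2) ℂ) - 1))) * Ω U ^ 2 ≤
      Ω (Function.update U e (U e * g)) ^ 2 := by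
  have h := vacuum_linkShift_ge hβ hΩm hΩb hΩnn heig e g U
  have hpos : 0 ≤ Real.exp (-(7 * Real.sqrt 2 * β * frobNorm ((g : Matrix (Fin 2) (Fin 2) ℂ) - 1))) * Ω U :=
    mul_nonneg (Real.exp_nonneg _) (hΩnn U)
  have h2 := pow_le_pow_left₀ hpos h 2
  have hexp : Real.exp (-(14 * Real.sqrt 2 * β * frobNorm ((g : Matrix (Fin 2) (Fin 2) ℂ) - 1))) =
      Real.exp (-(7 * Real.sqrt 2 * β * frobNorm ((g : Matrix (Fin 2) (Fin 2) ℂ) - 1))) ^ 2 := by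
    rw [← Real.exp_nat_mul]; congr 1; push_cast; ring
  rw [hexp, ← mul_pow]; exact h2

end Summit.QuantumFields.YangMills.Theorems.TransportFieldFano

end
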